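import Summits.QuantumAdvantage.QuantumAdvantage.Theorems.RankDialF1
import HarnessLib

/-!
# RankDial (F2) — §11ter `EquiRank ⟹ MassRank` (`massRank_of_equiRank`, `massRankLin_odd`), the CEILING `not_massRank_block`, the fat block, `mass_dial_sandwich`

TARGET BY NAME (cell decomp-qadv, RESIDUAL MODE): item stmt-QuantumAdvantage-23109
`Summit.QuantumAdvantage.QuantumAdvantage.Theses.OddPrimeWalk.ManyReadersSqrtOdd`, through rung R5 = `AdviceFreeQNC0.WalkHardFLinSel p`.
This file SUPPORTS the item (`--supports`); it does not close it.  Declaration bodies are byte-identical to the cell node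
«OlsonDial» (decomp-qadv lens-1 «grading / quantitative ladder», generation 26; node file sha256 6d975657…), cut into
≤ 400-line parts E1 (§7–§8) → E2 (§9–§10) → F1 (§11, §11bis) → F2 (§11ter) → F3 (§12); see part E1 for the whole node.
-/

set_option linter.dupNamespace false
set_option autoImplicit false

noncomputable section
open Classical

namespace Summit.QuantumAdvantage.QuantumAdvantage.Theorems.RankDial

open Finset
open Summit.QuantumAdvantage.AdviceFreeQNC0
open Literature.Computability.MetaComplexity Literature.Computability.MetaComplexity.Smolensky

/-! ### §11ter `EquiRank ⟹ MassRank` (so the min-mass law is PROVED at rank `ℓ/E`) and the CEILING of the min-mass law -/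

section MassRung
variable {p : ℕ}

/-- a class attaining the minimum on the fibre over `x` -/
def amin {d ℓ : ℕ} (Φ : Fin d → Fin ℓ → ZMod p) (x : Fin d → ZMod p) : ℕ :=
  if classCount Φ x 0 ≤ classCount Φ x 1 ∧ classCount Φ x 0 ≤ classCount Φ x 2 then 0
  else if classCount Φ x 1 ≤ classCount Φ x 2 then 1 else 2

/-- `amin < 3` -/
theorem amin_lt {d ℓ : ℕ} (Φ : Fin d → Fin ℓ → ZMod p) (x : Fin d → ZMod p) : amin Φ x < 3 := by
  unfold amin
  split_ifs <;> norm_num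

/-- `n_{amin}(x) = min_r n_r(x)` -/
theorem classCount_amin {d ℓ : ℕ} (Φ : Fin d → Fin ℓ → ZMod p) (x : Fin d → ZMod p) :
    classCount Φ x (amin Φ x) = minClass Φ x := by
  unfold amin minClass
  split_ifs <;> omega

/-- **`EquiRank p r ⟹ MassRank p r`** (with `C = 12`): on the sketch values whose minimal class is `b`, the law
bounds the two other classes by `(1/3 + 1/24)` of the mass each, so the minimal class carries `≥ 1/3 − 1/12` of it;
summing over `b`, `M(Φ) ≥ 2^ℓ/12`. -/
theorem massRank_of_equiRank {p : ℕ} {r : ℕ → ℕ} (hE : EquiRank p r) : MassRank p r := by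
  obtain ⟨ℓ₀, hEq⟩ := hE
  refine ⟨12, ℓ₀, fun ℓ hℓ d hd Φ => ?_⟩
  -- `A b` = #{v : amin(Φv) = b},  `B b r'` = #{v : |v| ≡ r' ∧ amin(Φv) = b}
  set A : ℕ → ℕ := fun b => (univ.filter fun v : Fin ℓ → Bool => amin Φ (skt Φ v) = b).card with hA
  set B : ℕ → ℕ → ℕ := fun b r' =>
    (univ.filter fun v : Fin ℓ → Bool => wt v % 3 = r' % 3 ∧ amin Φ (skt Φ v) = b).card with hB
  have hlaw : ∀ b r', 24 * B b r' ≤ 8 * A b + 2 ^ ℓ := by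
    intro b r'
    have h := hEq ℓ hℓ d hd Φ (fun x => decide (amin Φ x = b)) r' true
    simp only [decide_eq_true_eq] at h
    exact h
  have hpart : A 0 + A 1 + A 2 = 2 ^ ℓ := by
    have h := Finset.card_eq_sum_card_fiberwise (s := (univ : Finset (Fin ℓ → Bool))) (t := range 3)
      (f := fun v => amin Φ (skt Φ v)) (fun v _ => Finset.mem_coe.2 (Finset.mem_range.2 (amin_lt Φ _)))
    rw [Finset.card_univ, Fintype.card_fun, Fintype.card_bool, Fintype.card_fin, Finset.sum_range_succ,
      Finset.sum_range_succ, Finset.sum_range_succ, Finset.sum_range_zero, zero_add] at h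
    exact h.symm
  have hsplit : ∀ b, A b = B b 0 + B b 1 + B b 2 := by
    intro b
    have h := Finset.card_eq_sum_card_fiberwise (s := univ.filter fun v : Fin ℓ → Bool => amin Φ (skt Φ v) = b)
      (t := range 3) (f := fun v => wt v % 3)
      (fun v _ => Finset.mem_coe.2 (Finset.mem_range.2 (Nat.mod_lt _ (by norm_num))))
    rw [Finset.sum_range_succ, Finset.sum_range_succ, Finset.sum_range_succ, Finset.sum_range_zero, zero_add,
      Finset.filter_filter, Finset.filter_filter, Finset.filter_filter] at h
    have hc : ∀ r' : ℕ, r' < 3 →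
        (univ.filter fun v : Fin ℓ → Bool => amin Φ (skt Φ v) = b ∧ wt v % 3 = r').card = B b r' := by
      intro r' hr'
      show _ = (univ.filter fun v : Fin ℓ → Bool => wt v % 3 = r' % 3 ∧ amin Φ (skt Φ v) = b).card
      congr 1
      refine Finset.filter_congr fun v _ => ⟨fun hv => ⟨?_, hv.1⟩, fun hv => ⟨hv.2, ?_⟩⟩
      · rw [hv.2, Nat.mod_eq_of_lt hr']
      · rw [hv.1, Nat.mod_eq_of_lt hr']
    rw [hc 0 (by norm_num), hc 1 (by norm_num), hc 2 (by norm_num)] at h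
    exact h
  -- the diagonal terms add up to the min-mass
  have hdiag : ∀ b, B b b = ∑ x ∈ univ.image (skt Φ), if amin Φ x = b then classCount Φ x b else 0 := by
    intro b
    show (univ.filter fun v : Fin ℓ → Bool => wt v % 3 = b % 3 ∧ amin Φ (skt Φ v) = b).card = _
    rw [Finset.card_eq_sum_card_fiberwise
      (s := univ.filter fun v : Fin ℓ → Bool => wt v % 3 = b % 3 ∧ amin Φ (skt Φ v) = b)
      (t := univ.image (skt Φ)) (f := skt Φ)
      (fun v _ => Finset.mem_coe.2 (Finset.mem_image_of_mem _ (Finset.mem_univ v)))]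
    refine Finset.sum_congr rfl fun x _ => ?_
    by_cases hx : amin Φ x = b
    · rw [if_pos hx]
      unfold classCount fib
      rw [Finset.filter_filter, Finset.filter_filter]
      congr 1
      refine Finset.filter_congr fun v _ => ⟨fun hv => ⟨hv.2, ?_⟩, fun hv => ⟨⟨?_, by rw [hv.1]; exact hx⟩, hv.1⟩⟩
      · have hb := amin_lt Φ x
        rw [hx] at hb
        rw [hv.1.1, Nat.mod_eq_of_lt hb]
      · have hb := amin_lt Φ x
        rw [hx] at hb
        rw [hv.2, Nat.mod_eq_of_lt hb]
    · rw [if_neg hx]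
      refine Finset.card_eq_zero.2 (Finset.filter_eq_empty_iff.2 fun v hv hvx => hx ?_)
      rw [← hvx]
      exact (Finset.mem_filter.1 hv).2.2
  have hmin : B 0 0 + B 1 1 + B 2 2 = minMass Φ := by
    rw [hdiag, hdiag, hdiag, ← Finset.sum_add_distrib, ← Finset.sum_add_distrib]
    unfold minMass
    refine Finset.sum_congr rfl fun x _ => ?_
    have hlt := amin_lt Φ x
    have hc := classCount_amin Φ x
    generalize amin Φ x = m at hlt hc
    interval_cases m <;> simp [hc]
  have h01 := hlaw 0 1
  have h02 := hlaw 0 2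
  have h10 := hlaw 1 0
  have h12 := hlaw 1 2
  have h20 := hlaw 2 0
  have h21 := hlaw 2 1
  have hs0 := hsplit 0
  have hs1 := hsplit 1
  have hs2 := hsplit 2
  omega

/-- **RUNG PROVED: `MassRankLin p` for every `p ≥ 1` coprime to `3`**, in particular every prime `p ≥ 5`. -/
theorem massRankLin_of_coprime (p : ℕ) [NeZero p] (hp3 : p.Coprime 3) : MassRankLin p := by
  obtain ⟨E, hE, h⟩ := equiRank_of_coprime hp3
  exact ⟨E, hE, massRank_of_equiRank h⟩

/-- `p ≥ 5` prime. -/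
theorem massRankLin_odd (p : ℕ) [Fact p.Prime] (hp : 5 ≤ p) : MassRankLin p := by
  haveI : NeZero p := ⟨(Fact.out : p.Prime).ne_zero⟩
  exact massRankLin_of_coprime p ((Nat.coprime_primes Fact.out Nat.prime_three).mpr (by omega))

/-- **The block sketch has min-mass ZERO** (`t < p`): every fibre is a single weight. -/
theorem minMass_block [NeZero p] {m t : ℕ} (ht : t < p) : minMass (blockPhi p m t) = 0 := by
  unfold minMass
  refine Finset.sum_eq_zero fun x hx => ?_
  obtain ⟨v₀, _, rfl⟩ := Finset.mem_image.1 hx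
  have hw : ∀ v : Fin (m * t) → Bool, wt v = ∑ k, (skt (blockPhi p m t) v k).val := fun v => (block_wt ht v).symm
  have hr : (wt v₀ + 1) % 3 < 3 := Nat.mod_lt _ (by norm_num)
  have h0 : classCount (blockPhi p m t) (skt (blockPhi p m t) v₀) ((wt v₀ + 1) % 3) = 0 := by
    unfold classCount fib
    refine Finset.card_eq_zero.2 (Finset.filter_eq_empty_iff.2 fun v hv h => ?_)
    rw [Finset.mem_filter] at hv
    have hvw : wt v = wt v₀ := by rw [hw v, hw v₀, hv.2]
    omega
  have := minClass_le (blockPhi p m t) (skt (blockPhi p m t) v₀) _ hr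
  omega

/-- **CEILING: `MassRank p (ℓ ↦ ℓ/(p−1))` is FALSE** for every `p ≥ 2` — even the sharp law dies at rank fraction
`1/(p−1)` (so no window-only argument passes it: the high-rank piece needs cut structure). -/
theorem not_massRank_block (p : ℕ) [NeZero p] (hp : 2 ≤ p) : ¬ MassRank p (fun ℓ => ℓ / (p - 1)) := by
  rintro ⟨C, ℓ₀, h⟩
  obtain ⟨t, ht⟩ : ∃ t, p = t + 1 := ⟨p - 1, by omega⟩
  have htp : t < p := by omega
  have ht1 : 1 ≤ t := by omega
  have hpt : p - 1 = t := by omega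
  have hℓ : ℓ₀ ≤ (ℓ₀ + 1) * t := by nlinarith
  have hd : ℓ₀ + 1 ≤ (ℓ₀ + 1) * t / (p - 1) := by
    rw [hpt, Nat.mul_div_cancel _ (by omega)]
  have hlaw := h ((ℓ₀ + 1) * t) hℓ (ℓ₀ + 1) hd (blockPhi p (ℓ₀ + 1) t)
  rw [minMass_block htp, mul_zero] at hlaw
  exact absurd hlaw (not_le.2 (Nat.two_pow_pos _))

/-- **The min-mass sandwich at every prime `p ≥ 5`**: the sharp law HOLDS at rank `ℓ/E` and FAILS at rank `ℓ/(p−1)`. -/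
theorem mass_dial_sandwich (p : ℕ) [Fact p.Prime] (hp : 5 ≤ p) :
    MassRankLin p ∧ ¬ MassRank p (fun ℓ => ℓ / (p - 1)) := by
  haveI : NeZero p := ⟨(Fact.out : p.Prime).ne_zero⟩
  exact ⟨massRankLin_odd p hp, not_massRank_block p (by omega)⟩

/-- `EquiRankSharp ⟹ MassRankSharp` (the weaker conjecture suffices for the window pieces up to the ceiling). -/
theorem massRankSharp_of_equiRankSharp (h : EquiRankSharp p) : MassRankSharp p :=
  fun D hD => massRank_of_equiRank (h D hD)

/-- **The fat block has min-mass ZERO at `ℓ = 2p − 1`, `d = 1`** (`Φ = 𝟙`: a fibre is `{|v| ∈ {w, w+p}}`, two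
classes): `MassZeroBound` cannot be improved at `d = 1`, and the `ε = 0` end of the min-mass law sits STRICTLY above
the one-class bound `(p−1)d + 1`. -/
theorem minMass_fatBlock_eq_zero (p : ℕ) [Fact p.Prime] (hp3 : p ≠ 3) :
    minMass (fun (_ : Fin 1) (_ : Fin (2 * p - 1)) => (1 : ZMod p)) = 0 := by
  have hp : p.Prime := Fact.out
  have hp2 : 2 ≤ p := hp.two_le
  have hp3' : p % 3 ≠ 0 := fun h =>
    hp3 ((Nat.prime_dvd_prime_iff_eq Nat.prime_three hp).1 (Nat.dvd_of_mod_eq_zero h)).symm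
  unfold minMass
  refine Finset.sum_eq_zero fun x hx => ?_
  obtain ⟨v₀, _, rfl⟩ := Finset.mem_image.1 hx
  set Φ : Fin 1 → Fin (2 * p - 1) → ZMod p := fun _ _ => 1 with hΦ
  -- the sketch value is the weight mod p
  have hsk : ∀ v : Fin (2 * p - 1) → Bool, skt Φ v 0 = (wt v : ZMod p) := by
    intro v
    show (∑ j, if v j then (1 : ZMod p) else 0) = (wt v : ZMod p)
    rw [Finset.sum_boole]
    rfl
  have hle : ∀ v : Fin (2 * p - 1) → Bool, wt v ≤ 2 * p - 1 := by
    intro v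
    unfold wt
    exact (Finset.card_filter_le _ _).trans (by simp)
  -- every weight in the fibre is `w₀` or `w₀ + p`, `w₀ = |v₀| mod p`
  have hfib : ∀ v : Fin (2 * p - 1) → Bool, skt Φ v = skt Φ v₀ → wt v % 3 ≠ (wt v₀ % p + 2 * p) % 3 := by
    intro v hv
    have hmod : wt v % p = wt v₀ % p := by
      have h1 := congrFun hv 0
      rw [hsk, hsk] at h1
      have h2 := congrArg ZMod.val h1
      rwa [ZMod.val_natCast, ZMod.val_natCast] at h2
    have hq : wt v / p ≤ 1 := by
      have := Nat.div_le_div_right (c := p) (hle v)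
      have h2 : (2 * p - 1) / p = 1 := by
        rw [Nat.div_eq_of_lt_le] <;> omega
      omega
    have hdecomp := Nat.div_add_mod (wt v) p
    have hw0 : wt v₀ % p < p := Nat.mod_lt _ hp.pos
    rcases Nat.le_one_iff_eq_zero_or_eq_one.1 hq with hq0 | hq1
    · rw [hq0, mul_zero, zero_add] at hdecomp
      omega
    · rw [hq1, mul_one] at hdecomp
      omega
  have hr : (wt v₀ % p + 2 * p) % 3 < 3 := Nat.mod_lt _ (by norm_num)
  have h0 : classCount Φ (skt Φ v₀) ((wt v₀ % p + 2 * p) % 3) = 0 := by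
    unfold classCount fib
    refine Finset.card_eq_zero.2 (Finset.filter_eq_empty_iff.2 fun v hv h => ?_)
    rw [Finset.mem_filter] at hv
    exact hfib v hv.2 h
  have := minClass_le Φ (skt Φ v₀) _ hr
  omega

/-- `p = 3`: even rank `1` kills the min-mass law (`Φ = 𝟙` reads `|v| mod 3` itself). -/
theorem not_massRank_three : ¬ MassRank 3 (fun _ => 1) := by
  rintro ⟨C, ℓ₀, h⟩
  haveI : Fact (Nat.Prime 3) := ⟨Nat.prime_three⟩
  set Φ : Fin 1 → Fin ℓ₀ → ZMod 3 := fun _ _ => 1 with hΦ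
  have hsk : ∀ v : Fin ℓ₀ → Bool, skt Φ v 0 = (wt v : ZMod 3) := by
    intro v
    show (∑ j, if v j then (1 : ZMod 3) else 0) = (wt v : ZMod 3)
    rw [Finset.sum_boole]
    rfl
  have hM : minMass Φ = 0 := by
    unfold minMass
    refine Finset.sum_eq_zero fun x hx => ?_
    obtain ⟨v₀, _, rfl⟩ := Finset.mem_image.1 hx
    have hr : (wt v₀ + 1) % 3 < 3 := Nat.mod_lt _ (by norm_num)
    have h0 : classCount Φ (skt Φ v₀) ((wt v₀ + 1) % 3) = 0 := by
      unfold classCount fib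
      refine Finset.card_eq_zero.2 (Finset.filter_eq_empty_iff.2 fun v hv h => ?_)
      rw [Finset.mem_filter] at hv
      have h1 := congrFun hv.2 0
      rw [hsk, hsk] at h1
      have h2 := congrArg ZMod.val h1
      rw [ZMod.val_natCast, ZMod.val_natCast] at h2
      omega
    have := minClass_le Φ (skt Φ v₀) _ hr
    omega
  have hlaw := h ℓ₀ le_rfl 1 le_rfl Φ
  rw [hM, mul_zero] at hlaw
  exact absurd hlaw (not_le.2 (Nat.two_pow_pos _))

end MassRung

end Summit.QuantumAdvantage.QuantumAdvantage.Theorems.RankDial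

end
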